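import Mathlib
import Summits.KontsevichZagierPeriods.KontsevichZagierPeriods.Theorems.SoloInformedHookStates
import HarnessLib
import HarnessLib.Audit

/-!
# SoloInformed — the placement sum as a rational function (hook identities, file F3a)

Solo programme `solo-KontsevichZagierPeriods-informed`, session s53 (PROGRAMME LIII).

The iterated SCALE BAND STEP for the hook identities (Kaneko–Yamamoto's integral–series
identity for `l = (1,…,1)`) needs, at every step, a `SoloInformedScalePre` datum whose
`Φ = P/Q` is the placement sum `soloInformedHookSum w β K pos bs` of the coordinates already
placed (file F1c), in REDUCED form: the polynomial pair `(P, Q) = soloInformedHookPQ β K pos bs`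
is the sum, over the final states `(β', K')` (file F1d), of the chain fractions
`G(Q_0,…,Q_{K'}) = (∏_{t<K'} Q_t)/(∏_{t≤K'} (1 − Q_t))`, `Q_t = ∏_{β' l ≤ t} X_l`,
added up as ONE fraction by the schoolbook rule `P/Q + N/D = (P·D + Q·N)/(Q·D)`.

Main results (the two analytic fields of the step datum, and the value of `Φ`):
* `soloInformed_hookPQ_div_open`: on the open cube `P(w)/Q(w) = HookSum(w)`;
* `soloInformed_hookPQ_snd_pos`: `Q > 0` on the CLOSED active fibres `w|_{w_A ↦ t}`,
  `t ∈ [0,1]`,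
  for ANY coordinate `A` (every chain product contains a coordinate of block `0` other than
  `A`, and block `0` has `≥ 2` elements in every final state);
* `soloInformed_hookPQ_mono`: `t ↦ t·(P/Q)(w|_{w_A ↦ t})` is monotone on `[0,1]` (each chain
  fraction is nonnegative and nondecreasing in every entry on `[0,1)`).

No measure theory here; file F3b assembles the per-step data and chains the steps.

References: M. Kaneko, S. Yamamoto, arXiv:1605.03117, Prop. 5.4, Lemma 5.2; M. Hoffman,
Pacific J. Math. 152 (1992) Thm 5.1; Kontsevich–Zagier 2001 §1.2 [KontsevichZagier2001].
-/

noncomputable section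

open Set MvPolynomial

namespace Summit.KontsevichZagierPeriods.KontsevichZagierPeriods.Theorems

/-! ## 1. The chain fraction in closed form, and its monotonicity -/

section gq

/-- `G(f₀,…,f_k) = (∏_{r<k} f_r) / ∏_{r≤k} (1 − f_r)`. -/
theorem soloInformedGQ_ofFn_eq_div {k : ℕ} (f : Fin (k + 1) → ℝ) :
    soloInformedGQ (List.ofFn f) =
      (∏ r : Fin k, f (Fin.castSucc r)) / ∏ r : Fin (k + 1), (1 - f r) := by
  rw [soloInformedGQ_ofFn, Finset.prod_div_distrib, div_mul_div_comm, mul_one,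
    Fin.prod_univ_castSucc (fun r : Fin (k + 1) => 1 - f r)]

/-- **`G` is nonnegative and nondecreasing in every entry on `[0,1)`**: if
`0 ≤ f_r ≤ g_r < 1` for all `r` then `0 ≤ G(f) ≤ G(g)`. -/
theorem soloInformedGQ_ofFn_nonneg_le {k : ℕ} {f g : Fin (k + 1) → ℝ} (hf : ∀ r, 0 ≤ f r)
    (hfg : ∀ r, f r ≤ g r) (hg : ∀ r, g r < 1) :
    0 ≤ soloInformedGQ (List.ofFn f) ∧
      soloInformedGQ (List.ofFn f) ≤ soloInformedGQ (List.ofFn g) := by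
  rw [soloInformedGQ_ofFn_eq_div, soloInformedGQ_ofFn_eq_div]
  have hf1 : ∀ r, f r < 1 := fun r => (hfg r).trans_lt (hg r)
  have hDg : 0 < ∏ r : Fin (k + 1), (1 - g r) := Finset.prod_pos fun r _ => sub_pos.2 (hg r)
  have hDf : 0 < ∏ r : Fin (k + 1), (1 - f r) := Finset.prod_pos fun r _ => sub_pos.2 (hf1 r)
  have hNf : 0 ≤ ∏ r : Fin k, f (Fin.castSucc r) := Finset.prod_nonneg fun r _ => hf _
  refine ⟨div_nonneg hNf hDf.le,
    div_le_div₀ (Finset.prod_nonneg fun r _ => (hf _).trans (hfg _))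
    (Finset.prod_le_prod (fun r _ => hf _) fun r _ => hfg _) hDg
    (Finset.prod_le_prod (fun r _ => (sub_pos.2 (hg r)).le) fun r _ => sub_le_sub_left (hfg r) 1)⟩

end gq

/-! ## 2. A sum of fractions as one fraction -/

section sumnd

variable {N : ℕ}

/-- Numerator and denominator of a sum of polynomial fractions:
`ND [] = (0, 1)`, `ND ((P, Q) :: S) = (P·D' + Q·N', Q·D')` where `(N', D') = ND S`. -/
def soloInformedSumND :
    List (MvPolynomial (Fin N) ℚ × MvPolynomial (Fin N) ℚ) →
      MvPolynomial (Fin N) ℚ × MvPolynomial (Fin N) ℚ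
  | [] => (0, 1)
  | s :: S => (s.1 * (soloInformedSumND S).2 + s.2 * (soloInformedSumND S).1,
      s.2 * (soloInformedSumND S).2)

/-- `ND [] = (0, 1)`. -/
@[simp] theorem soloInformedSumND_nil :
    soloInformedSumND ([] : List (MvPolynomial (Fin N) ℚ × MvPolynomial (Fin N) ℚ)) = (0, 1) :=
  rfl

/-- `ND (s :: S) = (s.1·D' + s.2·N', s.2·D')`. -/
@[simp] theorem soloInformedSumND_cons (s : MvPolynomial (Fin N) ℚ × MvPolynomial (Fin N) ℚ)
    (S : List (MvPolynomial (Fin N) ℚ × MvPolynomial (Fin N) ℚ)) :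
    soloInformedSumND (s :: S) =
      (s.1 * (soloInformedSumND S).2 + s.2 * (soloInformedSumND S).1,
        s.2 * (soloInformedSumND S).2) := rfl

/-- The denominator of `ND S` is the product of the denominators. -/
theorem soloInformed_aeval_sumND_snd (x : Fin N → ℝ) :
    ∀ S : List (MvPolynomial (Fin N) ℚ × MvPolynomial (Fin N) ℚ),
      (aeval x (soloInformedSumND S).2 : ℝ) = (S.map fun s => (aeval x s.2 : ℝ)).prod
  | [] => by simp
  | s :: S => by
    rw [soloInformedSumND_cons, map_mul, soloInformed_aeval_sumND_snd x S,
      List.map_cons, List.prod_cons]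

/-- Positive denominators give a positive common denominator. -/
theorem soloInformed_aeval_sumND_snd_pos (x : Fin N → ℝ) :
    ∀ S : List (MvPolynomial (Fin N) ℚ × MvPolynomial (Fin N) ℚ),
      (∀ s ∈ S, 0 < (aeval x s.2 : ℝ)) → 0 < (aeval x (soloInformedSumND S).2 : ℝ)
  | [], _ => by simp
  | s :: S, h => by
    rw [soloInformedSumND_cons, map_mul]
    exact mul_pos (h s (by simp))
      (soloInformed_aeval_sumND_snd_pos x S fun s' hs' => h s' (List.mem_cons_of_mem s hs'))

/-- **`ND S` evaluates to the sum of the fractions** wherever no denominator vanishes. -/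
theorem soloInformed_aeval_sumND_div (x : Fin N → ℝ) :
    ∀ S : List (MvPolynomial (Fin N) ℚ × MvPolynomial (Fin N) ℚ),
      (∀ s ∈ S, (aeval x s.2 : ℝ) ≠ 0) →
      (aeval x (soloInformedSumND S).1 : ℝ) / aeval x (soloInformedSumND S).2 =
        (S.map fun s => (aeval x s.1 : ℝ) / aeval x s.2).sum
  | [], _ => by simp
  | s :: S, h => by
    have hs : (aeval x s.2 : ℝ) ≠ 0 := h s (by simp)
    have h' : ∀ s' ∈ S, (aeval x s'.2 : ℝ) ≠ 0 := fun s' hs' =>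
      h s' (List.mem_cons_of_mem s hs')
    have hS : (aeval x (soloInformedSumND S).2 : ℝ) ≠ 0 := by
      rw [soloInformed_aeval_sumND_snd]
      refine List.prod_ne_zero fun h0 => ?_
      obtain ⟨s', hs', hs'0⟩ := List.mem_map.1 h0
      exact h' s' hs' hs'0
    rw [soloInformedSumND_cons, map_add, map_mul, map_mul, map_mul, add_div,
      mul_div_mul_right _ _ hS, mul_div_mul_left _ _ hs, soloInformed_aeval_sumND_div x S h',
      List.map_cons, List.sum_cons]

end sumnd

/-! ## 3. The chain-product polynomials and the state fractions -/

section statepq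

variable {N : ℕ}

/-- The chain product `Q_t = ∏_{β l ≤ t} X_l` as a polynomial. -/
def soloInformedBPP (β : Fin N → ℕ) (t : ℕ) : MvPolynomial (Fin N) ℚ :=
  ∏ l ∈ Finset.univ.filter (fun l : Fin N => β l ≤ t), X l

/-- `Q_t(w)` is the chain product `soloInformedBP β w t`. -/
theorem soloInformed_aeval_BPP (β : Fin N → ℕ) (w : Fin N → ℝ) (t : ℕ) :
    (aeval w (soloInformedBPP β t) : ℝ) = soloInformedBP β w t := by
  simp [soloInformedBPP, soloInformedBP, map_prod]

/-- The fraction of a state `(β', K')`: `(∏_{t<K'} Q_t, ∏_{t≤K'} (1 − Q_t))`. -/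
def soloInformedStatePQ (p : (Fin N → ℕ) × ℕ) :
    MvPolynomial (Fin N) ℚ × MvPolynomial (Fin N) ℚ :=
  (∏ t : Fin p.2, soloInformedBPP p.1 t, ∏ t : Fin (p.2 + 1), (1 - soloInformedBPP p.1 t))

/-- The numerator of a state evaluates to `∏_{t<K'} Q_t(w)`. -/
theorem soloInformed_aeval_statePQ_fst (w : Fin N → ℝ) (p : (Fin N → ℕ) × ℕ) :
    (aeval w (soloInformedStatePQ p).1 : ℝ) = ∏ t : Fin p.2, soloInformedBP p.1 w t := by
  simp [soloInformedStatePQ, map_prod, soloInformed_aeval_BPP]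

/-- The denominator of a state evaluates to `∏_{t≤K'} (1 − Q_t(w))`. -/
theorem soloInformed_aeval_statePQ_snd (w : Fin N → ℝ) (p : (Fin N → ℕ) × ℕ) :
    (aeval w (soloInformedStatePQ p).2 : ℝ) =
      ∏ t : Fin (p.2 + 1), (1 - soloInformedBP p.1 w t) := by
  simp [soloInformedStatePQ, map_prod, soloInformed_aeval_BPP]

/-- **The state fraction evaluates to the chain function of the state.** -/
theorem soloInformed_statePQ_div (w : Fin N → ℝ) (p : (Fin N → ℕ) × ℕ) :
    (aeval w (soloInformedStatePQ p).1 : ℝ) / aeval w (soloInformedStatePQ p).2 =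
      soloInformedStateG w p := by
  rw [soloInformed_aeval_statePQ_fst, soloInformed_aeval_statePQ_snd]
  simp only [soloInformedStateG, soloInformedGQ_ofFn_eq_div, Fin.val_castSucc]

/-- If every chain product of the state is `< 1`, its denominator is positive. -/
theorem soloInformed_aeval_statePQ_snd_pos {w : Fin N → ℝ} {p : (Fin N → ℕ) × ℕ}
    (h : ∀ r : ℕ, soloInformedBP p.1 w r < 1) :
    0 < (aeval w (soloInformedStatePQ p).2 : ℝ) := by
  rw [soloInformed_aeval_statePQ_snd]
  exact Finset.prod_pos fun t _ => sub_pos.2 (h t)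

end statepq

/-! ## 4. Chain products on the closed active fibres -/

section closed

variable {N : ℕ}

/-- On a point of `[0,1]^N` with a coordinate of block `0` below `1`, every chain product lies
in `[0,1)`. -/
theorem soloInformed_BP_mem_Ico {β : Fin N → ℕ} {w : Fin N → ℝ}
    (hw : ∀ l, 0 ≤ w l ∧ w l ≤ 1)
    {l₀ : Fin N} (h0 : β l₀ = 0) (hl₀ : w l₀ < 1) (t : ℕ) :
    0 ≤ soloInformedBP β w t ∧ soloInformedBP β w t < 1 := by
  unfold soloInformedBP
  have hmem : l₀ ∈ Finset.univ.filter (fun l : Fin N => β l ≤ t) := by simp [h0]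
  refine ⟨Finset.prod_nonneg fun l _ => (hw l).1, ?_⟩
  rw [← Finset.mul_prod_erase _ _ hmem]
  calc w l₀ * ∏ x ∈ (Finset.univ.filter (fun l : Fin N => β l ≤ t)).erase l₀, w x
      ≤ w l₀ * 1 := mul_le_mul_of_nonneg_left
        (Finset.prod_le_one (fun l _ => (hw l).1) fun l _ => (hw l).2) (hw l₀).1
    _ < 1 := by rw [mul_one]; exact hl₀

/-- A block `0` of size `≥ 2` contains a coordinate other than `A`. -/
theorem soloInformed_exists_block_zero_ne {β : Fin N → ℕ} (h0 : 2 ≤ soloInformedFib β 0)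
    (A : Fin N) : ∃ l₀, β l₀ = 0 ∧ l₀ ≠ A := by
  have h1 : 1 < (Finset.univ.filter fun l : Fin N => β l = 0).card := h0
  obtain ⟨l₀, hl₀, hne⟩ := Finset.exists_mem_ne h1 A
  exact ⟨l₀, by simpa using hl₀, hne⟩

/-- Moving one coordinate of a point of the open cube inside `[0,1]` stays in `[0,1]^N`. -/
theorem soloInformed_update_mem_Icc {x : Fin N → ℝ} (hx : ∀ l, 0 < x l ∧ x l < 1)
    (A : Fin N) {t : ℝ} (ht : t ∈ Icc (0 : ℝ) 1) (l : Fin N) :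
    0 ≤ Function.update x A t l ∧ Function.update x A t l ≤ 1 := by
  by_cases h : l = A
  · subst h
    rw [Function.update_self]
    exact ht
  · rw [Function.update_of_ne h]
    exact ⟨(hx l).1.le, (hx l).2.le⟩

/-- **On the closed active fibre of any coordinate `A` the chain products of a labelling with
block `0` of size `≥ 2` lie in `[0,1)`.** -/
theorem soloInformed_BP_update_mem_Ico {β : Fin N → ℕ} (h0 : 2 ≤ soloInformedFib β 0)
    {x : Fin N → ℝ} (hx : ∀ l, 0 < x l ∧ x l < 1) (A : Fin N) {t : ℝ}
    (ht : t ∈ Icc (0 : ℝ) 1) (r : ℕ) :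
    0 ≤ soloInformedBP β (Function.update x A t) r ∧
      soloInformedBP β (Function.update x A t) r < 1 := by
  obtain ⟨l₀, hl₀, hne⟩ := soloInformed_exists_block_zero_ne h0 A
  exact soloInformed_BP_mem_Ico (soloInformed_update_mem_Icc hx A ht) hl₀
    (by rw [Function.update_of_ne hne]; exact (hx l₀).2) r

/-- **Monotonicity of a state in the active slot**: for `0 ≤ s ≤ t ≤ 1`,
`0 ≤ G(w|_{A ↦ s}) ≤ G(w|_{A ↦ t})`. -/
theorem soloInformed_stateG_update_mono {β : Fin N → ℕ} {K : ℕ}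
    (h0 : 2 ≤ soloInformedFib β 0)
    {x : Fin N → ℝ} (hx : ∀ l, 0 < x l ∧ x l < 1) (A : Fin N) {s t : ℝ}
    (hs : s ∈ Icc (0 : ℝ) 1) (ht : t ∈ Icc (0 : ℝ) 1) (hst : s ≤ t) :
    0 ≤ soloInformedStateG (Function.update x A s) (β, K) ∧
      soloInformedStateG (Function.update x A s) (β, K) ≤
        soloInformedStateG (Function.update x A t) (β, K) := by
  simp only [soloInformedStateG]
  refine soloInformedGQ_ofFn_nonneg_le
    (fun r => (soloInformed_BP_update_mem_Ico h0 hx A hs r).1) (fun r => ?_)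
    fun r => (soloInformed_BP_update_mem_Ico h0 hx A ht r).2
  unfold soloInformedBP
  refine Finset.prod_le_prod (fun l _ => (soloInformed_update_mem_Icc hx A hs l).1)
    fun l _ => ?_
  by_cases h : l = A
  · subst h
    rw [Function.update_self, Function.update_self]
    exact hst
  · rw [Function.update_of_ne h, Function.update_of_ne h]

end closed

/-! ## 5. The placement sum as one fraction -/

section hookpq

variable {N : ℕ}

/-- **The reduced fraction of the placement sum**: `(P, Q) = ND` of the state fractions of the
final states of `(β, K, pos; bs)`. -/
def soloInformedHookPQ (β : Fin N → ℕ) (K pos : ℕ) (bs : List (Fin N)) :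
    MvPolynomial (Fin N) ℚ × MvPolynomial (Fin N) ℚ :=
  soloInformedSumND ((soloInformedHookStates β K pos bs).map soloInformedStatePQ)

variable {β : Fin N → ℕ} {K pos : ℕ} {bs : List (Fin N)}

/-- **`P/Q = HookSum`** at every point where all chain products of all final states are
`< 1`. -/
theorem soloInformed_hookPQ_div {w : Fin N → ℝ}
    (hwS : ∀ p ∈ soloInformedHookStates β K pos bs, ∀ r : ℕ, soloInformedBP p.1 w r < 1) :
    (aeval w (soloInformedHookPQ β K pos bs).1 : ℝ) /
        aeval w (soloInformedHookPQ β K pos bs).2 =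
      soloInformedHookSum w β K pos bs := by
  unfold soloInformedHookPQ
  rw [soloInformed_aeval_sumND_div, List.map_map, soloInformed_hookSum_eq_states]
  · congr 1
    exact List.map_congr_left fun p _ => soloInformed_statePQ_div w p
  · intro s hs
    obtain ⟨p, hp, rfl⟩ := List.mem_map.1 hs
    exact (soloInformed_aeval_statePQ_snd_pos (hwS p hp)).ne'

/-- `Q > 0` at every point where all chain products of all final states are `< 1`. -/
theorem soloInformed_hookPQ_snd_pos_of {w : Fin N → ℝ}
    (hwS : ∀ p ∈ soloInformedHookStates β K pos bs, ∀ r : ℕ, soloInformedBP p.1 w r < 1) :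
    0 < (aeval w (soloInformedHookPQ β K pos bs).2 : ℝ) := by
  unfold soloInformedHookPQ
  refine soloInformed_aeval_sumND_snd_pos w _ fun s hs => ?_
  obtain ⟨p, hp, rfl⟩ := List.mem_map.1 hs
  exact soloInformed_aeval_statePQ_snd_pos (hwS p hp)

variable (hL : soloInformedIsLabK β K) (hpos : pos ≤ K) (hub : ∀ x ∈ bs, K < β x)
  (hnd : bs.Nodup)
include hL hpos hub hnd

/-- **On the open cube `P/Q = HookSum`.** -/
theorem soloInformed_hookPQ_div_open {w : Fin N → ℝ} (hw : ∀ l, 0 < w l ∧ w l < 1) :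
    (aeval w (soloInformedHookPQ β K pos bs).1 : ℝ) /
        aeval w (soloInformedHookPQ β K pos bs).2 =
      soloInformedHookSum w β K pos bs :=
  soloInformed_hookPQ_div fun p hp r =>
    (soloInformed_BP_mem_Ioo_of_fib hw
      (le_trans (by norm_num) (soloInformed_states_valid bs β K pos hL hpos hub hnd p hp).1.2) r).2

/-- **On the open cube `Q > 0`.** -/
theorem soloInformed_hookPQ_snd_pos_open {w : Fin N → ℝ} (hw : ∀ l, 0 < w l ∧ w l < 1) :
    0 < (aeval w (soloInformedHookPQ β K pos bs).2 : ℝ) :=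
  soloInformed_hookPQ_snd_pos_of fun p hp r =>
    (soloInformed_BP_mem_Ioo_of_fib hw
      (le_trans (by norm_num) (soloInformed_states_valid bs β K pos hL hpos hub hnd p hp).1.2) r).2

/-- **`Q > 0` on the closed active fibres** `x|_{x_A ↦ t}`, `t ∈ [0,1]`, of ANY coordinate `A`
(the field `Q_ne` of the step datum). -/
theorem soloInformed_hookPQ_snd_pos {x : Fin N → ℝ} (hx : ∀ l, 0 < x l ∧ x l < 1)
    (A : Fin N) {t : ℝ} (ht : t ∈ Icc (0 : ℝ) 1) :
    0 < (aeval (Function.update x A t) (soloInformedHookPQ β K pos bs).2 : ℝ) :=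
  soloInformed_hookPQ_snd_pos_of fun p hp r =>
    (soloInformed_BP_update_mem_Ico
      (soloInformed_states_valid bs β K pos hL hpos hub hnd p hp).1.2 hx A ht r).2

/-- **On the closed active fibres `P/Q = HookSum`.** -/
theorem soloInformed_hookPQ_div_update {x : Fin N → ℝ} (hx : ∀ l, 0 < x l ∧ x l < 1)
    (A : Fin N) {t : ℝ} (ht : t ∈ Icc (0 : ℝ) 1) :
    (aeval (Function.update x A t) (soloInformedHookPQ β K pos bs).1 : ℝ) /
        aeval (Function.update x A t) (soloInformedHookPQ β K pos bs).2 =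
      soloInformedHookSum (Function.update x A t) β K pos bs :=
  soloInformed_hookPQ_div fun p hp r =>
    (soloInformed_BP_update_mem_Ico
      (soloInformed_states_valid bs β K pos hL hpos hub hnd p hp).1.2 hx A ht r).2

/-- **Monotonicity of `t ↦ t·HookSum(x|_{x_A ↦ t})` on `[0,1]`** (a sum of nonnegative
nondecreasing chain functions, times `t`). -/
theorem soloInformed_hookSum_update_mono {x : Fin N → ℝ} (hx : ∀ l, 0 < x l ∧ x l < 1)
    (A : Fin N) :
    MonotoneOn (fun t : ℝ => t * soloInformedHookSum (Function.update x A t) β K pos bs)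
      (Icc 0 1) := by
  intro s hs t ht hst
  simp only [soloInformed_hookSum_eq_states]
  rw [← List.sum_map_mul_left, ← List.sum_map_mul_left]
  refine List.sum_le_sum fun p hp => ?_
  have h0 : 2 ≤ soloInformedFib p.1 0 :=
    (soloInformed_states_valid bs β K pos hL hpos hub hnd p hp).1.2
  obtain ⟨β', K'⟩ := p
  have hm := soloInformed_stateG_update_mono (K := K') h0 hx A hs ht hst
  exact mul_le_mul hst hm.2 hm.1 ht.1

/-- **The field `mono` of the step datum**: `t ↦ t·(P/Q)(x|_{x_A ↦ t})` is monotone on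
`[0,1]`. -/
theorem soloInformed_hookPQ_mono {x : Fin N → ℝ} (hx : ∀ l, 0 < x l ∧ x l < 1) (A : Fin N) :
    MonotoneOn (fun t : ℝ => t *
      ((aeval (Function.update x A t) (soloInformedHookPQ β K pos bs).1 : ℝ) /
        aeval (Function.update x A t) (soloInformedHookPQ β K pos bs).2)) (Icc 0 1) :=
  (soloInformed_hookSum_update_mono hL hpos hub hnd hx A).congr fun t ht => by
    simp only
    rw [soloInformed_hookPQ_div_update hL hpos hub hnd hx A ht]

/-- `HookSum ≥ 0` on the open cube. -/
theorem soloInformed_hookSum_nonneg {w : Fin N → ℝ} (hw : ∀ l, 0 < w l ∧ w l < 1) :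
    0 ≤ soloInformedHookSum w β K pos bs := by
  rw [soloInformed_hookSum_eq_states]
  refine List.sum_nonneg fun g hg => ?_
  obtain ⟨p, hp, rfl⟩ := List.mem_map.1 hg
  have h1 : 1 ≤ soloInformedFib p.1 0 :=
    le_trans (by norm_num) (soloInformed_states_valid bs β K pos hL hpos hub hnd p hp).1.2
  exact (soloInformedGQ_pos _ fun q hq => by
    obtain ⟨t, rfl⟩ := List.mem_ofFn.1 hq
    exact soloInformed_BP_mem_Ioo_of_fib hw h1 t).le

end hookpq

/-! ## 6. Sanity: the empty placement is the chain fraction of `β` itself -/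

/-- With nothing placed, `(P, Q)` is the state fraction of `(β, K)` up to the unit fraction:
`HookPQ β K pos [] = (P_β·1 + Q_β·0, Q_β·1)`. -/
theorem soloInformed_hookPQ_nil {N : ℕ} (β : Fin N → ℕ) (K pos : ℕ) :
    soloInformedHookPQ β K pos [] =
      ((soloInformedStatePQ (β, K)).1 * 1 + (soloInformedStatePQ (β, K)).2 * 0,
        (soloInformedStatePQ (β, K)).2 * 1) := by
  simp [soloInformedHookPQ]


end Summit.KontsevichZagierPeriods.KontsevichZagierPeriods.Theorems
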